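import Summits.QuantumFields.BalabanUV.T4Continuum.Support.ShellMeasureLandauEndRayStokesAssembled
import Summits.QuantumFields.BalabanUV.T4Continuum.Support.ShellMeasureLandauWilsonSquaresKernelsSchwarz

/-!
# `T4Continuum.ShellMeasureLandauEndRayStokesAssembledDecay` — row S85 f2, file 5: THE FINAL HOST «γ6 + S81 + S71 f2 ⊕ S78» —
# END-II-final ASSEMBLED with the Wilson slot fired AT THE READING OF RECORD, LOCATED, AT TWO RADII, every pinned chain
# binder INHABITED (S81) and the four linear letters' pinned bounds read from DISPLAYED DECAY KERNELS (S69 (A))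
(cell `pub-balaban`, sub-cell `t4`, spine estimate NE7c (node U5b); NE7c ROUND-2 crew, unit
`b2b-balaban-t4-ne7c-formalise-leaf-09` gen 12; owner table `t4/b2b-balaban-t4-ne7c-p1/LEAVES-NE7c-P1.md` row **S85 f2** (rulings
R-ne7cp1-g32-2 (b) and R-ne7cp1-g32-4 «when the declaration with BOTH the Schwarz Wilson slot AND S81's kernel inhabitants of the
six pinned chain binders lands, THAT declaration supersedes as most-assembled (owner accepts in advance)»; host settled with
leaf-04-g7 on the journal, l.18286 «YOU host the final END» → l.18354); ADDITIVE — imports this row's file 4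
`ShellMeasureLandauWilsonSquaresKernelsSchwarz` (`hE_landau_wilsonSquares_located_schwarz_of_decay`; the pattern is leaf-04-g7's
S80 f2 `ShellMeasureLandauWilsonSquaresKernels` p228956) and leaf-04-g6's S80 `ShellMeasureLandauEndRayStokesAssembled` (p227677:
`wilsonProfile_nonneg`; hence S76 f2 `ShellMeasureLandauEndFinal`, S71 f2 `ShellMeasureRayTermsPinnedLandau`, S78
`ShellMeasureRayLogIntegral`) ONLY; every supplier consumed BY NAME; the statement is generated from this row's file 3
`ShellMeasureLandauEndRayStokesAssembledSchwarz` (p228876) by replacing the (T2) binder block; [folklore]; 0 `def`,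
0 `def … : Prop`, 0 sorry, 0 citation tags)

HONEST FRAMING.  Finite four-torus programme, rung (B)+1 only — NOT infinite volume, NOT a mass gap, NOT the Clay
problem, NOT summit progress; (B), `BetaPertHyp`, (B^μ) not consumed.  NE7c (`T4IndicatorShell.ShellWeightBound`) is
NOT PRINTED and NOT PROVED; «NE7c ⇐ the named binders» (+ F-ne7cp1-g30-1 decay halves, + F-ne7cp1-g31-1 curl read-out);
(M1) realized ≠ NE7c (c3).  Nothing printed is asserted: the equation numbers in binder comments LOCATE displayed SHAPES
((P2), (P4), (118)∕(121), (103), (75), (44), (46), (54); B9 (3.133)∕Thm 3.3; B11 (19)∕(25)∕(37); B12 (2.18)–(2.22); B14 (2.17)),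
not citations.  HONEST DEPENDENCY (cell): continuum YM on T⁴ ⇐ BetaPertH ∧ nine spine estimates (0/9 proved); BetaPertH ⇐
(D1) ∧ (D4) ∧ CAP+tail; G-an2-4 gates asym, D1 and NE2/3/4.

THE THREE TUPLES (R-ne7cp1-g31-2, displayed, not reconciled here): (T1) the LOCALIZED (classifier) scheme tuple of the END,
flat norms (S76) — UNCHANGED; (T2) the GLOBAL scheme tuple AT THE READING OF RECORD: five FLAT pi-type chain spaces
`Λw → 𝔄w`, `Λz → ℭ`, `Λw′ → 𝔄′`, `Λx → 𝔅`, `Λb → 𝔇` read by `(toPiL (pinW δw (ϖw ∘ pos·)) 1).symm` for ONE pin profile `ϖw`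
on a common position space (one-sided Lipschitz for `dis`), the four linear letters `𝒢 ι H H₁ := kerOp (k· V)` given as
V-indexed DECAY KERNELS with V-uniform constants and reduced-rate row sums, the flat printed-TYPE lists, LOCALITY of the (P4)
and (44) letters with reaches `r_W`, `r_C`, the block support of the coarse field, the two contraction numbers
`c_𝒢M_𝒢·2C₄a₃e^{δw r_W} < 1`, `2C₂R·e^{δw r_C}·(c_ιM_ι)(c_HM_H) < 1`, weight read-outs BLIND off located supports with FLAT
op-norms `κ̄_w` and curl op-norm `κ̄_c` (F-ne7cp1-g31-1 (A): `∝ η²`, located), the located count `Σ_p e^{−δw ϖP p} ≤ K_w`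
— NOTHING PINNED DISPLAYED (file 4 §2); (T3) the global tuple's PINNED INSTANCE `WSup (pinW δ′ ϖ) 1 𝔄` for the located
non-Wilson terms (S71 f2) — UNCHANGED, as in S80.
* **`slotAC_realized_su2_landauChart_assembled_decay`** — S76 f2 `…_final` with `hEW := file 4
  hE_landau_wilsonSquares_located_schwarz_of_decay` (per exterior section `V`), `hBW` the located SECOND-ORDER Wilson constant
  `B_W⁽²⁾ = 3·|β|·((d̄ + 2S̄∕(r_Φ,w∕S))·(2S̄∕(r_Φ,w∕S)))·K_w` (`S̄ = κ̄_c z_pin + expTail₂(m_w κ̄_w z_pin)`,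
  `z_pin = (c_{H₁}M_{H₁})·b_w∕((1 − (c_𝒢M_𝒢)·(2C₄a₃e^{δw r_W}))(1 − 2C₂R_C·e^{δw r_C}·(c_ιM_ι)·(c_HM_H)))`; `0 ≤ B_W⁽²⁾` proved
  here from the displayed numbers), `hWlb := S80 wilsonProfile_nonneg` BY NAME at this instance,
  `hEE := rayBound_add (S71 f2 hE_landau_chartRay_pinned) (S78 rayBound_of_logIntegral)` EXACTLY as S80; slot constant
  **`2(m₀ + (B_W⁽²⁾ + (3·LK·2z̄_e∕(r_Φ,e∕S − 1) + B_d)))∕(1 − δ)`** — no `1∕(r_Φ,w∕S − 1)`, no `#P_w`, no volume on the Wilson side.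
WHAT REMAINS A BINDER (c2∕c3): the (T1) scheme∕read-out∕real-structure data, the flat printed-TYPE lists of (T2)∕(T3), the four
decay kernels with their row sums, the two localities, the block support, the blind flat read-outs with `κ̄_w`, `κ̄_c`, the
located count `K_w`, `LK` (S71 §3), the ω-uniform ray constant `B_d` with `hint`∕`hpos` (S78), the lower bounds, co-test∕window
data, numbers, [dict] (`hRdict`∕`hudict`).  No estimate of Bałaban's is discharged; NOT a K-uniformity failure (γ6 is a CONSTANT
audit at the IR end); NOTHING in the countdown moves; NE7c NOT PROVED; spine PROVED 0∕9.
-/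

noncomputable section

open Set Metric NormedSpace MeasureTheory Function

namespace Summit.QuantumFields.BalabanUV.T4Continuum.ShellMeasureLandauEndRayStokesAssembledDecay

open scoped ENNReal
open Literature.MathematicalPhysics.QuantumFieldTheory.Balaban1983to89
open B11Prop6Scheme (Prop4Hyp)
open GaugeField (GaugeInvariant)
open T4ShellMeasure (SlotAntiConcentration)
open T4CubePoincare (cube)
open T4CubeChartGnomonic (SU2)
open T4CubeChartExp (expFibreChart)
open T4TreeGaugeFixing (NoClosedLoop fixTo)
open T4ShellMeasurePlaquette (expTail₂)
open ShellMeasureLevelAssembly (classifier)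
open ShellMeasureMultiGridNorms (WSup)
open ShellMeasurePinnedNorm (pinW)
open ShellMeasureLandauHolonomy (solAt landauExp)
open ShellMeasureLandauHolonomyChart (holOf cplx)
open ShellMeasureLandauHolonomySkew (readOutReal)
open ShellMeasureRayTermsPinnedLandau (hE_landau_chartRay_pinned)
open ShellMeasureRayLogIntegral (rayBound_of_logIntegral rayBound_add)
open ShellMeasureLandauEndFinal (slotAC_realized_su2_landauChart_final)
open ShellMeasureLandauEndRayStokesAssembled (wilsonProfile_nonneg)
open ShellMeasureDecayKernelSums (kerOp)
open ShellMeasureLandauWilsonSquaresKernelsSchwarz (hE_landau_wilsonSquares_located_schwarz_of_decay)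

/-! ## END-II-final ASSEMBLED at the reading of record: Wilson slot located, two radii, decay kernels displayed -/

section Assembled

open scoped Matrix.Norms.L2Operator

variable {P : Params} {j : ℕ} [DecidableEq (PBond P j)]
variable {n : Type*} [Fintype n] [DecidableEq n] [Nonempty n]
variable {𝒴 𝒴' 𝒳 𝒵 ℬ : Type*} [NormedAddCommGroup 𝒴] [NormedSpace ℂ 𝒴] [CompleteSpace 𝒴]
  [NormedAddCommGroup 𝒴'] [NormedSpace ℂ 𝒴'] [NormedAddCommGroup 𝒳] [NormedSpace ℂ 𝒳] [CompleteSpace 𝒳]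
  [NormedAddCommGroup 𝒵] [NormedSpace ℂ 𝒵] [NormedAddCommGroup ℬ] [NormedSpace ℂ ℬ]

/-- **END-II-FINAL, ASSEMBLED AT THE READING OF RECORD — WILSON SLOT LOCATED, AT TWO RADII, NOTHING PINNED DISPLAYED**
(row S85 f2 file 5; supersedes this row's file 3 `…_assembled_schwarz` and S80 `…_assembled` as the most-assembled declaration per
R-ne7cp1-g32-4).  S76 f2 `ShellMeasureLandauEndFinal.slotAC_realized_su2_landauChart_final` with BOTH 𝓔-slots DISCHARGED by the
suppliers of record, per exterior section `V`: the Wilson slot by file 4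
`ShellMeasureLandauWilsonSquaresKernelsSchwarz.hE_landau_wilsonSquares_located_schwarz_of_decay` over (T2) AT THE READING OF
RECORD (five flat pi-type chain spaces; the four linear letters as V-indexed DECAY KERNELS `k𝒢 kι kH kH₁` with V-uniform
constants `c·e^{−δ·dis}` and reduced-rate row sums `≤ M·`; the flat lists with Sect. C at radius `RCw`, `6(ε₄w + B₀w bw) ≤ RCw`;
localities `NW`∕`NC` with reaches; block support of `Φw V`; `2S ≤ r_Φ,w`; read-outs blind off `suppw p` at depth `ϖPw p`, flat
op-norms `κ̄_w`, curl op-norm `κ̄_c`; unitary `B_p` with `‖B_p − 1‖ ≤ d_p ≤ d̄`; located count `Σ_p e^{−δw ϖPw p} ≤ K_w`), its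
nonnegativity `hWlb` by S80 `wilsonProfile_nonneg` BY NAME, the non-Wilson slot by S71 f2 `hE_landau_chartRay_pinned` over (T3)
⊕ S78 `rayBound_of_logIntegral` through `rayBound_add` EXACTLY as S80.  CONCLUSION: (M1) per slot at the classifier threshold
`εθ·η²` with the slot constant `2(m₀ + (B_W⁽²⁾ + (3·LK·2z̄_e∕(r_Φ,e∕S − 1) + B_d)))∕(1 − δ)`,
`B_W⁽²⁾ = 3·|β|·((d̄ + 2S̄∕(r_Φ,w∕S))·(2S̄∕(r_Φ,w∕S)))·K_w` written out (`S̄ = κ̄_c z_pin + expTail₂(m_w κ̄_w z_pin)`,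
`z_pin = (c_{H₁}M_{H₁})b_w∕((1 − c_𝒢M_𝒢·2C₄a₃e^{δw r_W})(1 − 2C₂R_C e^{δw r_C}(c_ιM_ι)(c_HM_H)))`).  Every hypothesis is a
scheme∕read-out∕real-structure datum of one of the three displayed tuples, a decay kernel with its row sum, a locality, a located
budget (`K_w`, `LK`, `B_d`), a lower bound, a co-test∕window datum or a number; CONDITIONAL on all of them; nothing PRINTED is
asserted; NOT Bałaban's minimiser; (M1) realized ≠ NE7c. [folklore] -/
theorem slotAC_realized_su2_landauChart_assembled_decay {T : Finset (PBond P j)} (hT : NoClosedLoop T)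
    (U₀ : GaugeField P j SU2) (Λ : Finset (PBond P j)) {m₀ : ℕ} (e : ↥Λ × Fin 3 ≃ Fin m₀)
    {S : ℝ} (hS : 0 < S) (hSπ : 3 * S ^ 2 < Real.pi ^ 2) (c : GaugeField P j SU2 → GaugeField P j SU2)
    {F : GaugeField P j SU2 → ℝ≥0∞} (hF : Measurable F) (hFi : GaugeInvariant F)
    (hFsupp : ∀ V y, F (fixTo T U₀ (updateFinset V Λ y)) ≠ 0 →
      ∀ b (hb : b ∈ Λ), dist1 ((c V b)⁻¹ * y ⟨b, hb⟩) ≤ 2 * Real.sin (S / 2))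
    {u : GaugeField P j SU2 → ℝ} (hu : Measurable u) (hui : GaugeInvariant u)
    {ι : Type*} {Pu : Finset ι} (hPu : Pu.Nonempty)
    (W : GaugeField P j SU2 → Set (Fin m₀ → ℝ)) (Jco : GaugeField P j SU2 → (Fin m₀ → ℝ) → ℝ≥0∞)
    {δ ρ β : ℝ}
    (𝒢 : GaugeField P j SU2 → (𝒵 →L[ℂ] 𝒴)) (W𝒱 : GaugeField P j SU2 → 𝒴 → 𝒵) {B₀ C₄ a₃ ε₄ : ℝ}
    (h𝒢 : ∀ V f, ‖𝒢 V f‖ ≤ B₀ * ‖f‖) (hW : ∀ V, Prop4Hyp (W𝒱 V) C₄ a₃) (hB₀ : 0 < B₀) (hC₄ : 0 ≤ C₄)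
    (hε₄ : 0 ≤ ε₄)
    {dL C₁ B₃ ε₁ : ℝ} (hdL : 0 ≤ dL) (hC₁ : 0 ≤ C₁) (hε₁ : 0 ≤ ε₁) (hB₃ : dL ≤ B₃)
    (h1 : 2 * B₀ * C₁ * B₃ * ε₁ ≤ ε₄) (h2 : 4 * ε₄ ≤ a₃) (h3 : 16 * B₀ * C₄ * ε₄ ≤ 1)
    (H₁ : GaugeField P j SU2 → (ℬ →L[ℂ] 𝒴)) (hH₁ : ∀ V B, ‖H₁ V B‖ ≤ B₀ * ‖B‖)
    (Φ : GaugeField P j SU2 → (Fin m₀ → ℂ) → ℬ) {rΦ : ℝ} (hΦd : ∀ V, DifferentiableOn ℂ (Φ V) (ball 0 rΦ))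
    (hΦ0 : ∀ V, Φ V 0 = 0) (hΦ : ∀ V, ∀ z ∈ ball (0 : Fin m₀ → ℂ) rΦ, ‖Φ V z‖ < 2 * dL * C₁ * ε₁) (hSr : S < rΦ)
    (Cf : GaugeField P j SU2 → 𝒴' → 𝒳) {C₂ RC : ℝ} (hC₂ : 0 ≤ C₂)
    (hCq : ∀ V, ∀ Z : 𝒴', ‖Z‖ < RC → ‖Cf V Z‖ ≤ C₂ * ‖Z‖ ^ 2) (hCd : ∀ V, DifferentiableOn ℂ (Cf V) (ball 0 RC))
    (ιs : GaugeField P j SU2 → (𝒴 →L[ℂ] 𝒴')) (hι : ∀ V Y, ‖ιs V Y‖ ≤ ‖Y‖)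
    (Hop : GaugeField P j SU2 → (𝒳 →L[ℂ] 𝒴)) (hH : ∀ V X, ‖Hop V X‖ ≤ B₀ * ‖X‖)
    {ε₃ : ℝ} (h18 : 18 * C₂ * B₀ * ε₃ ≤ 1) (hcoup : ε₄ + B₀ * (2 * dL * C₁ * ε₁) ≤ ε₃) (h3R : 3 * ε₃ ≤ RC)
    (ℓs : ι → List (𝒴 →L[ℂ] Matrix n n ℂ)) {κr : ℝ} (hκ : 0 ≤ κr)
    (hℓ : ∀ p ∈ Pu, ∀ ℓ ∈ ℓs p, ∀ Y, ‖ℓ Y‖ ≤ κr * ‖Y‖) {m : ℕ} (hlen : ∀ p ∈ Pu, (ℓs p).length ≤ m)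
    {κc : ℝ} (hκc : 0 ≤ κc) (hcurl : ∀ p ∈ Pu, ∀ Y, ‖((ℓs p).map fun ℓ => ℓ Y).sum‖ ≤ κc * ‖Y‖)
    -- ══ (T2) THE WILSON SLOT'S SUPPLIER DATA AT THE READING OF RECORD (file 4
    -- `ShellMeasureLandauWilsonSquaresKernelsSchwarz.hE_landau_wilsonSquares_located_schwarz_of_decay`, per exterior section `V`,
    -- V-uniform constants): five FLAT pi-type chain spaces, ONE pin profile on a common position space (one-sided Lipschitz),
    -- the four linear letters as V-indexed DECAY KERNELS with reduced-rate row sums ((3.133)∕Thm 3.3, (46), (103) decay-halves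
    -- TYPE — LOCATORS), the flat printed-TYPE lists, two localities with reaches, the block support of the coarse field, blind
    -- flat read-outs, the located count — NOTHING PINNED DISPLAYED; the Wilson budget LOCATED and SECOND ORDER (γ6) ══
    {Λw Λz Λw' Λx Λb 𝔖 : Type*} [Fintype Λw] [DecidableEq Λw] [Fintype Λz] [Fintype Λw'] [Fintype Λx] [Fintype Λb]
    {𝔄w ℭ 𝔄' 𝔅 𝔇 : Type*} [NormedAddCommGroup 𝔄w] [NormedSpace ℂ 𝔄w] [CompleteSpace 𝔄w]
    [NormedAddCommGroup ℭ] [NormedSpace ℂ ℭ] [NormedAddCommGroup 𝔄'] [NormedSpace ℂ 𝔄']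
    [NormedAddCommGroup 𝔅] [NormedSpace ℂ 𝔅] [CompleteSpace 𝔅] [NormedAddCommGroup 𝔇] [NormedSpace ℂ 𝔇]
    {δw : ℝ} (hδw : 0 ≤ δw) (ϖw : 𝔖 → ℝ) (dis : 𝔖 → 𝔖 → ℝ) (hϖw : ∀ x y, ϖw x ≤ ϖw y + dis x y)
    (pos : Λw → 𝔖) (posz : Λz → 𝔖) (pos' : Λw' → 𝔖) (posx : Λx → 𝔖) (posb : Λb → 𝔖)
    (k𝒢 : GaugeField P j SU2 → Λw → Λz → (ℭ →L[ℂ] 𝔄w)) (kι : GaugeField P j SU2 → Λw' → Λw → (𝔄w →L[ℂ] 𝔄'))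
    (kH : GaugeField P j SU2 → Λw → Λx → (𝔅 →L[ℂ] 𝔄w)) (kH₁ : GaugeField P j SU2 → Λw → Λb → (𝔇 →L[ℂ] 𝔄w))
    {c𝒢 δ𝒢 M𝒢 cι δι Mι cH δH MH cH₁ δH₁ MH₁ : ℝ}
    (hc𝒢 : 0 ≤ c𝒢) (hM𝒢 : 0 ≤ M𝒢) (hk𝒢 : ∀ V c b', ‖k𝒢 V c b'‖ ≤ c𝒢 * Real.exp (-(δ𝒢 * dis (pos c) (posz b'))))
    (hM𝒢' : ∀ x, ∑ b', Real.exp (-((δ𝒢 - δw) * dis x (posz b'))) ≤ M𝒢)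
    (hcι : 0 ≤ cι) (hMι : 0 ≤ Mι) (hkι : ∀ V c b', ‖kι V c b'‖ ≤ cι * Real.exp (-(δι * dis (pos' c) (pos b'))))
    (hMι' : ∀ x, ∑ b', Real.exp (-((δι - δw) * dis x (pos b'))) ≤ Mι)
    (hcH : 0 ≤ cH) (hMH : 0 ≤ MH) (hkH : ∀ V c b', ‖kH V c b'‖ ≤ cH * Real.exp (-(δH * dis (pos c) (posx b'))))
    (hMH' : ∀ x, ∑ b', Real.exp (-((δH - δw) * dis x (posx b'))) ≤ MH)
    (hcH₁ : 0 ≤ cH₁) (hMH₁ : 0 ≤ MH₁) (hkH₁ : ∀ V c b', ‖kH₁ V c b'‖ ≤ cH₁ * Real.exp (-(δH₁ * dis (pos c) (posb b'))))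
    (hMH₁' : ∀ x, ∑ b', Real.exp (-((δH₁ - δw) * dis x (posb b'))) ≤ MH₁)
    -- the flat lists (P2)∕(P4)∕(118)∕(121)∕(103)∕(75)-TYPE∕(44) at radius `RCw` with `6(ε₄w + B₀w·bw) ≤ RCw`∕scaling∕(46)∕(54)
    (W𝒱w : GaugeField P j SU2 → (Λw → 𝔄w) → (Λz → ℭ)) {B₀w C₄w a₃w ε₄w bw : ℝ}
    (h𝒢w : ∀ V f, ‖kerOp (k𝒢 V) f‖ ≤ B₀w * ‖f‖) (hWw : ∀ V, Prop4Hyp (W𝒱w V) C₄w a₃w) (hB₀w : 0 < B₀w) (hC₄w : 0 ≤ C₄w)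
    (hε₄w : 0 ≤ ε₄w) (hdomw : 2 * (ε₄w + B₀w * bw) ≤ a₃w) (hselfw : B₀w * C₄w * (ε₄w + B₀w * bw) ^ 2 ≤ ε₄w)
    (hcontrw : 4 * B₀w * C₄w * (ε₄w + B₀w * bw) < 1) (hH₁w : ∀ V B, ‖kerOp (kH₁ V) B‖ ≤ B₀w * ‖B‖)
    (Φw : GaugeField P j SU2 → (Fin m₀ → ℂ) → (Λb → 𝔇)) {rΦw : ℝ} (hΦdw : ∀ V, DifferentiableOn ℂ (Φw V) (ball 0 rΦw))
    (hΦ0w : ∀ V, Φw V 0 = 0) (hΦbw : ∀ V, ∀ z ∈ ball (0 : Fin m₀ → ℂ) rΦw, ‖Φw V z‖ < bw) (h2Sw : 2 * S ≤ rΦw)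
    (Cw : GaugeField P j SU2 → (Λw' → 𝔄') → (Λx → 𝔅)) {C₂w RCw : ℝ} (hC₂w : 0 ≤ C₂w)
    (hCqw : ∀ V, ∀ Z : Λw' → 𝔄', ‖Z‖ < RCw → ‖Cw V Z‖ ≤ C₂w * ‖Z‖ ^ 2) (hCdw : ∀ V, DifferentiableOn ℂ (Cw V) (ball 0 RCw))
    (hιw : ∀ V Y, ‖kerOp (kι V) Y‖ ≤ ‖Y‖) (hHw : ∀ V X, ‖kerOp (kH V) X‖ ≤ B₀w * ‖X‖)
    (hqw : 9 * C₂w * B₀w * (ε₄w + B₀w * bw) < 1) (hRCw : 6 * (ε₄w + B₀w * bw) ≤ RCw)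
    -- localities with reaches, the block support, the two contraction numbers (DISPLAYED arithmetic on the decay constants)
    (NW : Λz → Λw → Prop)
    (hlocW : ∀ V, ∀ A A' : Λw → 𝔄w, ∀ c', (∀ b', NW c' b' → A b' = A' b') → W𝒱w V A c' = W𝒱w V A' c')
    {rW : ℝ} (hreachW : ∀ c' b', NW c' b' → ϖw (posz c') - rW ≤ ϖw (pos b'))
    (NC : Λx → Λw' → Prop)
    (hlocC : ∀ V, ∀ A A' : Λw' → 𝔄', ∀ c', (∀ b', NC c' b' → A b' = A' b') → Cw V A c' = Cw V A' c')
    {rC : ℝ} (hreachC : ∀ c' b', NC c' b' → ϖw (posx c') - rC ≤ ϖw (pos' b'))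
    (hsupp : ∀ V, ∀ z : Fin m₀ → ℂ, ∀ i, 0 < ϖw (posb i) → Φw V z i = 0)
    (hqW : c𝒢 * M𝒢 * (2 * C₄w * a₃w * Real.exp (δw * rW)) < 1)
    (hk : 2 * C₂w * RCw * Real.exp (δw * rC) * (cι * Mι) * (cH * MH) < 1)
    -- weight plaquettes; read-outs BLIND off located supports, FLAT op-norms, curl op-norm (DISPLAYED; `κ_c ∝ η²`), lengths
    {𝔭 : Type*} (Pw : Finset 𝔭) (ℓw : 𝔭 → List ((Λw → 𝔄w) →L[ℂ] Matrix n n ℂ)) (suppw : 𝔭 → Finset Λw)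
    (ϖPw : 𝔭 → ℝ)
    (hblindw : ∀ p ∈ Pw, ∀ ℓ ∈ ℓw p, ∀ A A' : Λw → 𝔄w, (∀ b' ∈ suppw p, A b' = A' b') → ℓ A = ℓ A')
    (hdepthw : ∀ p ∈ Pw, ∀ b' ∈ suppw p, ϖPw p ≤ ϖw (pos b')) (hϖPw : ∀ p ∈ Pw, 0 ≤ ϖPw p)
    {κwb κcb : ℝ} (hκwb : 0 ≤ κwb) (hκcb : 0 ≤ κcb) (hℓwb : ∀ p ∈ Pw, ∀ ℓ ∈ ℓw p, ‖ℓ‖ ≤ κwb)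
    (hcurlw : ∀ p ∈ Pw, ‖(ℓw p).sum‖ ≤ κcb)
    {mw : ℕ} (hlenw : ∀ p ∈ Pw, (ℓw p).length ≤ mw)
    -- the global tuple's real structure with SKEW weight read-outs
    (𝓡𝒴w : AddSubgroup (Λw → 𝔄w)) (h𝓡𝒴w : IsClosed (𝓡𝒴w : Set (Λw → 𝔄w))) (𝓡𝒵w : AddSubgroup (Λz → ℭ))
    (𝓡𝒴w' : AddSubgroup (Λw' → 𝔄')) (𝓡𝒳w : AddSubgroup (Λx → 𝔅)) (h𝓡𝒳w : IsClosed (𝓡𝒳w : Set (Λx → 𝔅)))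
    (𝓡ℬw : AddSubgroup (Λb → 𝔇))
    (h𝒢rw : ∀ V, ∀ f ∈ 𝓡𝒵w, kerOp (k𝒢 V) f ∈ 𝓡𝒴w) (hWrw : ∀ V, ∀ Y ∈ 𝓡𝒴w, W𝒱w V Y ∈ 𝓡𝒵w)
    (hιrw : ∀ V, ∀ Y ∈ 𝓡𝒴w, kerOp (kι V) Y ∈ 𝓡𝒴w') (hHrw : ∀ V, ∀ X ∈ 𝓡𝒳w, kerOp (kH V) X ∈ 𝓡𝒴w)
    (hCrw : ∀ V, ∀ Z ∈ 𝓡𝒴w', Cw V Z ∈ 𝓡𝒳w) (hH₁rw : ∀ V, ∀ B ∈ 𝓡ℬw, kerOp (kH₁ V) B ∈ 𝓡𝒴w)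
    (hΦrw : ∀ V, ∀ y : Fin m₀ → ℝ, ‖y‖ ≤ S → Φw V (cplx y) ∈ 𝓡ℬw)
    (hskew : ∀ p ∈ Pw, ∀ ℓ ∈ ℓw p, ∀ Y ∈ 𝓡𝒴w, ℓ Y ∈ skewAdjoint (Matrix n n ℂ))
    -- the frozen background plaquettes (N-ne7cp1-g31-2) with a uniform size bound, the located count, `0 ≤ β`
    (Bp : GaugeField P j SU2 → 𝔭 → Matrix n n ℂ) {d : 𝔭 → ℝ} {dbar : ℝ}
    (hBu : ∀ V, ∀ p ∈ Pw, Bp V p ∈ unitary (Matrix n n ℂ)) (hBd : ∀ V, ∀ p ∈ Pw, ‖Bp V p - 1‖ ≤ d p)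
    (hd : ∀ p ∈ Pw, d p ≤ dbar) (hdbar : 0 ≤ dbar)
    {Kw : ℝ} (hKw : ∑ p ∈ Pw, Real.exp (-(δw * ϖPw p)) ≤ Kw)
    -- ══ (T3) THE LOCATED NON-WILSON TERMS' SUPPLIER DATA (S71 f2 `hE_landau_chartRay_pinned`): the global tuple's PINNED
    -- INSTANCE `𝒴 := WSup (pinW δ′ ϖ) 1 𝔄`, located per-term functionals, pin depths, located sum `LK`, coupling ══
    {Λe : Type*} [Fintype Λe] {𝔄 : Type*} [NormedAddCommGroup 𝔄] [NormedSpace ℂ 𝔄] [CompleteSpace 𝔄] {δ' : ℝ} {ϖ : Λe → ℝ}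
    (hδ' : 0 ≤ δ') (hϖ : ∀ b', 0 ≤ ϖ b')
    {𝒴e' 𝒳e 𝒵e ℬe : Type*} [NormedAddCommGroup 𝒴e'] [NormedSpace ℂ 𝒴e'] [NormedAddCommGroup 𝒳e] [NormedSpace ℂ 𝒳e]
    [CompleteSpace 𝒳e] [NormedAddCommGroup 𝒵e] [NormedSpace ℂ 𝒵e] [NormedAddCommGroup ℬe] [NormedSpace ℂ ℬe]
    (𝒢e : GaugeField P j SU2 → (𝒵e →L[ℂ] WSup (pinW δ' ϖ) 1 𝔄)) (W𝒱e : GaugeField P j SU2 → WSup (pinW δ' ϖ) 1 𝔄 → 𝒵e)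
    {B₀e C₄e a₃e be ε₄e : ℝ}
    (h𝒢e : ∀ V f, ‖𝒢e V f‖ ≤ B₀e * ‖f‖) (hWe : ∀ V, Prop4Hyp (W𝒱e V) C₄e a₃e) (hB₀e : 0 < B₀e) (hC₄e : 0 ≤ C₄e)
    (hbe : 0 ≤ be) (hε₄e : 0 ≤ ε₄e) (hdome : 2 * (ε₄e + B₀e * be) ≤ a₃e)
    (hselfe : B₀e * C₄e * (ε₄e + B₀e * be) ^ 2 ≤ ε₄e) (hcontre : 4 * B₀e * C₄e * (ε₄e + B₀e * be) < 1)
    (H₁e : GaugeField P j SU2 → (ℬe →L[ℂ] WSup (pinW δ' ϖ) 1 𝔄)) (hH₁e : ∀ V B, ‖H₁e V B‖ ≤ B₀e * ‖B‖)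
    (Φe : GaugeField P j SU2 → (Fin m₀ → ℂ) → ℬe) {rΦe : ℝ} (hΦde : ∀ V, DifferentiableOn ℂ (Φe V) (ball 0 rΦe))
    (hΦ0e : ∀ V, Φe V 0 = 0) (hΦbe : ∀ V, ∀ z ∈ ball (0 : Fin m₀ → ℂ) rΦe, ‖Φe V z‖ < be) (hSre : S < rΦe)
    (Ce : GaugeField P j SU2 → 𝒴e' → 𝒳e) {C₂e RCe : ℝ} (hC₂e : 0 ≤ C₂e)
    (hCqe : ∀ V, ∀ Z : 𝒴e', ‖Z‖ < RCe → ‖Ce V Z‖ ≤ C₂e * ‖Z‖ ^ 2) (hCde : ∀ V, DifferentiableOn ℂ (Ce V) (ball 0 RCe))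
    (ιe : GaugeField P j SU2 → (WSup (pinW δ' ϖ) 1 𝔄 →L[ℂ] 𝒴e')) (hιe : ∀ V Y, ‖ιe V Y‖ ≤ ‖Y‖)
    (He : GaugeField P j SU2 → (𝒳e →L[ℂ] WSup (pinW δ' ϖ) 1 𝔄)) (hHe : ∀ V X, ‖He V X‖ ≤ B₀e * ‖X‖)
    (hqe : 9 * C₂e * B₀e * (ε₄e + B₀e * be) < 1) (hRCe : 3 * (ε₄e + B₀e * be) ≤ RCe)
    {𝔱 : Type*} (I : Finset 𝔱) {Ef : 𝔱 → (Λe → 𝔄) → ℂ} {rE : ℝ} {ee : 𝔱 → ℝ} (hrE : 0 < rE)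
    (hEd : ∀ i ∈ I, DifferentiableOn ℂ (Ef i) (ball 0 rE))
    (hEb : ∀ i ∈ I, ∀ Z ∈ ball (0 : Λe → 𝔄) rE, ‖Ef i Z‖ ≤ ee i) (he0 : ∀ i ∈ I, 0 ≤ ee i)
    (supp : 𝔱 → Finset Λe) (hblind : ∀ i ∈ I, ∀ A₁ A₂ : Λe → 𝔄, (∀ b' ∈ supp i, A₁ b' = A₂ b') → Ef i A₁ = Ef i A₂)
    (ϖP : 𝔱 → ℝ) (hdepth : ∀ i ∈ I, ∀ b' ∈ supp i, ϖP i ≤ ϖ b')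
    {LK : ℝ} (hLK : 0 ≤ LK) (hK : ∑ i ∈ I, 2 * ee i / rE * Real.exp (-(δ' * ϖP i)) ≤ LK)
    (hcoupE : ((ε₄e + B₀e * be) + B₀e * (4 * C₂e * (ε₄e + B₀e * be) ^ 2)) ≤ rE / 2)
    {BE₁ : ℝ} (hElb₁ : ∀ V (y : Fin m₀ → ℝ), ‖y‖ ≤ S → -BE₁ ≤
      (∑ i ∈ I, Ef i (WSup.toPiL (𝔄 := 𝔄) (pinW δ' ϖ) 1
        (landauExp (Ce V) (ιe V) (He V) (4 * C₂e * (ε₄e + B₀e * be) ^ 2)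
          (solAt (𝒢e V) 0 (W𝒱e V) ε₄e (0 : 𝒵e) (H₁e V (Φe V (cplx y))) + H₁e V (Φe V (cplx y)))))).re)
    -- ══ (S78) THE FLUCTUATION-DRESSED TERMS: `−log ∫ g e^{A} dμ` with an ω-UNIFORM ray constant `B_d`, integrability and
    -- positivity of the dressed integral, a lower bound on the S-ball (all DISPLAYED) ══
    {Ω : Type*} [MeasurableSpace Ω] (μ : Measure Ω) {g : Ω → ℝ} (hg : ∀ ω, 0 ≤ g ω)
    (A : GaugeField P j SU2 → (Fin m₀ → ℝ) → Ω → ℝ) {Bd : ℝ} (hBd0 : 0 ≤ Bd)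
    (hint : ∀ V, ∀ x ∈ W V, ∀ c : ℝ, 1 / 2 ≤ c → c ≤ 1 → Integrable (fun ω => g ω * Real.exp (A V (c • x) ω)) μ)
    (hpos : ∀ V, ∀ x ∈ W V, ∀ c : ℝ, 1 / 2 ≤ c → c ≤ 1 → 0 < ∫ ω, g ω * Real.exp (A V (c • x) ω) ∂μ)
    (hA : ∀ V, ∀ x ∈ W V, ∀ c : ℝ, 1 / 2 ≤ c → c ≤ 1 → ∀ ω, A V x ω ≤ A V (c • x) ω + (1 - c) * Bd)
    {BE₂ : ℝ} (hElb₂ : ∀ V (y : Fin m₀ → ℝ), ‖y‖ ≤ S → -BE₂ ≤ (-Real.log (∫ ω, g ω * Real.exp (A V y ω) ∂μ)))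
    (L : Set (𝒴 →L[ℂ] Matrix n n ℂ))
    (𝓡𝒵 : AddSubgroup 𝒵) (𝓡𝒴' : AddSubgroup 𝒴') (𝓡𝒳 : AddSubgroup 𝒳) (h𝓡𝒳 : IsClosed (𝓡𝒳 : Set 𝒳))
    (𝓡ℬ : AddSubgroup ℬ)
    (h𝒢r : ∀ V, ∀ f ∈ 𝓡𝒵, 𝒢 V f ∈ readOutReal L) (hWr : ∀ V, ∀ Y ∈ readOutReal L, W𝒱 V Y ∈ 𝓡𝒵)
    (hιr : ∀ V, ∀ Y ∈ readOutReal L, ιs V Y ∈ 𝓡𝒴') (hHr : ∀ V, ∀ X ∈ 𝓡𝒳, Hop V X ∈ readOutReal L)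
    (hCr : ∀ V, ∀ Z ∈ 𝓡𝒴', Cf V Z ∈ 𝓡𝒳) (hH₁r : ∀ V, ∀ B ∈ 𝓡ℬ, H₁ V B ∈ readOutReal L)
    (hΦr : ∀ V, ∀ y : Fin m₀ → ℝ, ‖y‖ ≤ S → Φ V (cplx y) ∈ 𝓡ℬ)
    (hRdict : ∀ V, ∀ x ∈ cube m₀ S,
      F (fixTo T U₀ (updateFinset V Λ (expFibreChart Λ (c V) e x))) =
        Jco V x * ENNReal.ofReal (Real.exp (-((∑ p ∈ Pw, β * (1 - (Matrix.trace (Bp V p * holOf (ℓw p)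
            (fun y => landauExp (Cw V) (kerOp (kι V)) (kerOp (kH V)) (4 * C₂w * (ε₄w + B₀w * bw) ^ 2)
              (solAt (kerOp (k𝒢 V)) 0 (W𝒱w V) ε₄w (0 : Λz → ℭ) (kerOp (kH₁ V) (Φw V (cplx y))) +
                kerOp (kH₁ V) (Φw V (cplx y)))) x)).re /
            Fintype.card n)) +
          ((∑ i ∈ I, Ef i (WSup.toPiL (𝔄 := 𝔄) (pinW δ' ϖ) 1
            (landauExp (Ce V) (ιe V) (He V) (4 * C₂e * (ε₄e + B₀e * be) ^ 2)
              (solAt (𝒢e V) 0 (W𝒱e V) ε₄e (0 : 𝒵e) (H₁e V (Φe V (cplx x))) + H₁e V (Φe V (cplx x)))))).re +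
          (-Real.log (∫ ω, g ω * Real.exp (A V x ω) ∂μ)))))))
    (hudict : ∀ V, ∀ x ∈ cube m₀ S,
      u (fixTo T U₀ (updateFinset V Λ (expFibreChart Λ (c V) e x))) =
        classifier hPu (fun p => holOf (ℓs p) (fun y => landauExp (Cf V) (ιs V) (Hop V)
          (4 * C₂ * (ε₄ + B₀ * (2 * dL * C₁ * ε₁)) ^ 2)
          (solAt (𝒢 V) 0 (W𝒱 V) ε₄ (0 : 𝒵) (H₁ V (Φ V (cplx y))) + H₁ V (Φ V (cplx y))))) x)
    (hJW : ∀ V x, Jco V x ≠ 0 → x ∈ W V)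
    (hJ : ∀ V x, ∀ a : ℝ, 0 ≤ a → Jco V x ≤ Jco V (Real.exp (-a) • x))
    (hJ1 : ∀ V x, Jco V x ≤ 1)
    (hWS : ∀ V, W V ⊆ closedBall (0 : Fin m₀ → ℝ) S)
    (hδ0 : 0 ≤ δ) (hδ1 : δ < 1) (hρ0 : 0 ≤ ρ) (hρ : ρ ≤ (1 - δ) / 2) (hβ : 0 ≤ β)
    -- SM-L2 (SM) DISCHARGED IN THE STOKES CURRENCY (S73 `hSM_of_stokes`): the η-scalings of the classifier's read-out data
    -- DISPLAYED — curl read-out × field size `κ_c·z̄ ≤ c₁η²z` (B11 (25)∕(37) TYPE), letter size `κ_r·z̄ ≤ c₂ηz` ((19) TYPE),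
    -- regime `m·κ_r·z̄ ≤ 1` — the UNIT-currency smallness `36(c₁z + m²c₂²z²)∕(r_Φ∕S − 1)² ≤ δ·εθ`, and the classifier
    -- threshold `θ := εθ·η²` (B14 (2.17) TYPE): the `η²` CANCELS
    {η εθ c₁ c₂ z : ℝ} (hη : 0 < η) (hεθ : 0 < εθ)
    (hs₁ : κc * ((ε₄ + B₀ * (2 * dL * C₁ * ε₁)) + B₀ * (4 * C₂ * (ε₄ + B₀ * (2 * dL * C₁ * ε₁)) ^ 2)) ≤ c₁ * η ^ 2 * z)
    (ha : κr * ((ε₄ + B₀ * (2 * dL * C₁ * ε₁)) + B₀ * (4 * C₂ * (ε₄ + B₀ * (2 * dL * C₁ * ε₁)) ^ 2)) ≤ c₂ * η * z)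
    (hma : m * (κr * ((ε₄ + B₀ * (2 * dL * C₁ * ε₁)) + B₀ * (4 * C₂ * (ε₄ + B₀ * (2 * dL * C₁ * ε₁)) ^ 2))) ≤ 1)
    (hsm : 36 * (c₁ * z + m ^ 2 * c₂ ^ 2 * z ^ 2) / (rΦ / S - 1) ^ 2 ≤ δ * εθ) :
    SlotAntiConcentration ((fieldMeasure P j SU2).withDensity F) u (εθ * η ^ 2) ρ
      (2 * ((m₀ : ℝ) + (3 * (|β| * ((dbar +
          2 * (κcb * (cH₁ * MH₁ * bw / ((1 - c𝒢 * M𝒢 * (2 * C₄w * a₃w * Real.exp (δw * rW))) *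
              (1 - 2 * C₂w * RCw * Real.exp (δw * rC) * (cι * Mι) * (cH * MH)))) +
            expTail₂ (mw * (κwb * (cH₁ * MH₁ * bw / ((1 - c𝒢 * M𝒢 * (2 * C₄w * a₃w * Real.exp (δw * rW))) *
              (1 - 2 * C₂w * RCw * Real.exp (δw * rC) * (cι * Mι) * (cH * MH))))))) / (rΦw / S)) *
          (2 * (κcb * (cH₁ * MH₁ * bw / ((1 - c𝒢 * M𝒢 * (2 * C₄w * a₃w * Real.exp (δw * rW))) *
              (1 - 2 * C₂w * RCw * Real.exp (δw * rC) * (cι * Mι) * (cH * MH)))) +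
            expTail₂ (mw * (κwb * (cH₁ * MH₁ * bw / ((1 - c𝒢 * M𝒢 * (2 * C₄w * a₃w * Real.exp (δw * rW))) *
              (1 - 2 * C₂w * RCw * Real.exp (δw * rC) * (cι * Mι) * (cH * MH))))))) / (rΦw / S))) * Kw) +
        (3 * (LK * (2 * ((ε₄e + B₀e * be) + B₀e * (4 * C₂e * (ε₄e + B₀e * be) ^ 2)))) / (rΦe / S - 1) + Bd))) / (1 - δ)) := by
  have hSrw : S < rΦw := by linarith
  have hRade : 1 < rΦe / S := by rw [lt_div_iff₀ hS]; linarith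
  have hzE : 0 ≤ ((ε₄e + B₀e * be) + B₀e * (4 * C₂e * (ε₄e + B₀e * be) ^ 2)) := by positivity
  -- sizes for the located second-order Wilson constant and for the profile's nonnegativity
  have hbw : 0 ≤ bw := (norm_nonneg _).trans (hΦbw U₀ 0 (mem_ball_self (by linarith))).le
  have hεw : 0 ≤ ε₄w + B₀w * bw := add_nonneg hε₄w (mul_nonneg hB₀w.le hbw)
  have hRCw3 : 3 * (ε₄w + B₀w * bw) ≤ RCw := by linarith
  have hBW : 0 ≤ 3 * (|β| * ((dbar +
          2 * (κcb * (cH₁ * MH₁ * bw / ((1 - c𝒢 * M𝒢 * (2 * C₄w * a₃w * Real.exp (δw * rW))) *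
              (1 - 2 * C₂w * RCw * Real.exp (δw * rC) * (cι * Mι) * (cH * MH)))) +
            expTail₂ (mw * (κwb * (cH₁ * MH₁ * bw / ((1 - c𝒢 * M𝒢 * (2 * C₄w * a₃w * Real.exp (δw * rW))) *
              (1 - 2 * C₂w * RCw * Real.exp (δw * rC) * (cι * Mι) * (cH * MH))))))) / (rΦw / S)) *
          (2 * (κcb * (cH₁ * MH₁ * bw / ((1 - c𝒢 * M𝒢 * (2 * C₄w * a₃w * Real.exp (δw * rW))) *
              (1 - 2 * C₂w * RCw * Real.exp (δw * rC) * (cι * Mι) * (cH * MH)))) +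
            expTail₂ (mw * (κwb * (cH₁ * MH₁ * bw / ((1 - c𝒢 * M𝒢 * (2 * C₄w * a₃w * Real.exp (δw * rW))) *
              (1 - 2 * C₂w * RCw * Real.exp (δw * rC) * (cι * Mι) * (cH * MH))))))) / (rΦw / S))) * Kw) := by
    have hKw0 : 0 ≤ Kw := (Finset.sum_nonneg fun _ _ => Real.exp_nonneg _).trans hKw
    have hk1 : 0 < 1 - 2 * C₂w * RCw * Real.exp (δw * rC) * (cι * Mι) * (cH * MH) := by linarith
    have hs1 : 0 < 1 - c𝒢 * M𝒢 * (2 * C₄w * a₃w * Real.exp (δw * rW)) := by linarith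
    have hz : 0 ≤ (cH₁ * MH₁ * bw / ((1 - c𝒢 * M𝒢 * (2 * C₄w * a₃w * Real.exp (δw * rW))) *
              (1 - 2 * C₂w * RCw * Real.exp (δw * rC) * (cι * Mι) * (cH * MH)))) :=
      div_nonneg (mul_nonneg (mul_nonneg hcH₁ hMH₁) hbw) (mul_pos hs1 hk1).le
    have hSbar : 0 ≤ (κcb * (cH₁ * MH₁ * bw / ((1 - c𝒢 * M𝒢 * (2 * C₄w * a₃w * Real.exp (δw * rW))) *
          (1 - 2 * C₂w * RCw * Real.exp (δw * rC) * (cι * Mι) * (cH * MH)))) +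
        expTail₂ (mw * (κwb * (cH₁ * MH₁ * bw / ((1 - c𝒢 * M𝒢 * (2 * C₄w * a₃w * Real.exp (δw * rW))) *
          (1 - 2 * C₂w * RCw * Real.exp (δw * rC) * (cι * Mι) * (cH * MH))))))) :=
      add_nonneg (mul_nonneg hκcb hz) (T4ShellMeasurePlaquette.expTail₂_nonneg _)
    have hRad : 0 < rΦw / S := div_pos (by linarith) hS
    have h2S' : 0 ≤ 2 * (κcb * (cH₁ * MH₁ * bw / ((1 - c𝒢 * M𝒢 * (2 * C₄w * a₃w * Real.exp (δw * rW))) *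
              (1 - 2 * C₂w * RCw * Real.exp (δw * rC) * (cι * Mι) * (cH * MH)))) +
            expTail₂ (mw * (κwb * (cH₁ * MH₁ * bw / ((1 - c𝒢 * M𝒢 * (2 * C₄w * a₃w * Real.exp (δw * rW))) *
              (1 - 2 * C₂w * RCw * Real.exp (δw * rC) * (cι * Mι) * (cH * MH))))))) / (rΦw / S) :=
      div_nonneg (mul_nonneg zero_le_two hSbar) hRad.le
    exact mul_nonneg (by norm_num) (mul_nonneg (mul_nonneg (abs_nonneg β)
      (mul_nonneg (add_nonneg hdbar h2S') h2S')) hKw0)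
  have hBE : 0 ≤ 3 * (LK * (2 * ((ε₄e + B₀e * be) + B₀e * (4 * C₂e * (ε₄e + B₀e * be) ^ 2)))) / (rΦe / S - 1) + Bd :=
    add_nonneg (div_nonneg (by positivity) (by linarith)) hBd0
  refine slotAC_realized_su2_landauChart_final hT U₀ Λ e hS hSπ c hF hFi hFsupp hu hui hPu W Jco 𝒢 W𝒱 h𝒢 hW hB₀
    hC₄ hε₄ hdL hC₁ hε₁ hB₃ h1 h2 h3 H₁ hH₁ Φ hΦd hΦ0 hΦ hSr Cf hC₂ hCq hCd ιs hι Hop hH h18 hcoup h3R ℓs hκ hℓ hlen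
    hκc hcurl
    (fun V y => ∑ p ∈ Pw, β * (1 - (Matrix.trace (Bp V p * holOf (ℓw p)
      (fun y => landauExp (Cw V) (kerOp (kι V)) (kerOp (kH V)) (4 * C₂w * (ε₄w + B₀w * bw) ^ 2)
        (solAt (kerOp (k𝒢 V)) 0 (W𝒱w V) ε₄w (0 : Λz → ℭ) (kerOp (kH₁ V) (Φw V (cplx y))) +
          kerOp (kH₁ V) (Φw V (cplx y)))) y)).re /
          Fintype.card n))
    (fun V y => (∑ i ∈ I, Ef i (WSup.toPiL (𝔄 := 𝔄) (pinW δ' ϖ) 1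
      (landauExp (Ce V) (ιe V) (He V) (4 * C₂e * (ε₄e + B₀e * be) ^ 2)
        (solAt (𝒢e V) 0 (W𝒱e V) ε₄e (0 : 𝒵e) (H₁e V (Φe V (cplx y))) + H₁e V (Φe V (cplx y)))))).re +
      (-Real.log (∫ ω, g ω * Real.exp (A V y ω) ∂μ)))
    (BElb := BE₁ + BE₂)
    (fun V x hx c' hc hc1 => ?_) hBW (fun V x hx c' hc hc1 => ?_) hBE (fun V y hy => ?_) (fun V y hy => ?_)
    L 𝓡𝒵 𝓡𝒴' 𝓡𝒳 h𝓡𝒳 𝓡ℬ h𝒢r hWr hιr hHr hCr hH₁r hΦr (fun V x hx => by simpa only using hRdict V x hx) hudict hJW hJ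
    hJ1 hWS hδ0 hδ1 hρ0 hρ hβ hη hεθ hs₁ ha hma hsm
  · -- the WILSON slot AT THE READING OF RECORD, TWO RADII, LOCATED: file 4 `…_located_schwarz_of_decay` per exterior section
    exact hE_landau_wilsonSquares_located_schwarz_of_decay hS (hWS V) hδw ϖw dis hϖw pos posz pos' posx posb (k𝒢 V) (kι V)
      (kH V) (kH₁ V) hc𝒢 hM𝒢 (hk𝒢 V) hM𝒢' hcι hMι (hkι V) hMι' hcH hMH (hkH V) hMH' hcH₁ hMH₁ (hkH₁ V) hMH₁' (h𝒢w V)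
      (hWw V) hB₀w hC₄w hε₄w hdomw hselfw hcontrw (hH₁w V) (hΦdw V) (hΦ0w V) (hΦbw V) h2Sw hC₂w (hCqw V) (hCdw V)
      (hιw V) (hHw V) hqw hRCw NW (hlocW V) hreachW NC (hlocC V) hreachC (hsupp V) hqW hk ℓw suppw ϖPw hblindw hdepthw
      hϖPw hκwb hκcb hℓwb hcurlw hlenw 𝓡𝒴w h𝓡𝒴w 𝓡𝒵w 𝓡𝒴w' 𝓡𝒳w h𝓡𝒳w 𝓡ℬw (h𝒢rw V) (hWrw V) (hιrw V) (hHrw V)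
      (hCrw V) (hH₁rw V) (hΦrw V) hskew (Bp V) (hBu V) (hBd V) hd hdbar hKw β x hx c' hc hc1
  · -- the NON-WILSON slot: S71 f2 located terms ⊕ S78 dressed terms (`rayBound_add`)
    have h1 := hE_landau_chartRay_pinned hδ' hϖ hS (hWS V) (h𝒢e V) (hWe V) hB₀e hC₄e hε₄e hdome hselfe hcontre
      (H₁e V) (hH₁e V) (hΦde V) (hΦ0e V) (hΦbe V) hSre hC₂e (hCqe V) (hCde V) (ιe V) (hιe V) (He V) (hHe V) hqe hRCe
      I hrE hEd hEb he0 supp hblind ϖP hdepth hK hcoupE x hx c' hc hc1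
    have h2 := rayBound_of_logIntegral μ hg (A V) (hint V) (hpos V) (hA V) x hx c' hc hc1
    simp only at h1 h2 ⊢
    linarith
  · -- the Wilson profile is nonnegative at real chart points (S80 §1b BY NAME)
    exact wilsonProfile_nonneg Pw (h𝒢w V) (hWw V) hB₀w hC₄w hε₄w hdomw hselfw hcontrw (kerOp (kH₁ V)) (hH₁w V)
      (hΦbw V) hSrw hC₂w (hCqw V) (hCdw V) (kerOp (kι V)) (hιw V) (kerOp (kH V)) (hHw V) hqw hRCw3 ℓw 𝓡𝒴w h𝓡𝒴w 𝓡𝒵w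
      𝓡𝒴w' 𝓡𝒳w h𝓡𝒳w 𝓡ℬw (h𝒢rw V) (hWrw V) (hιrw V) (hHrw V) (hCrw V) (hH₁rw V) (hΦrw V) hskew (Bp V) (hBu V) hβ hy
  · -- the lower bound of the non-Wilson part
    have h1 := hElb₁ V y hy
    have h2 := hElb₂ V y hy
    linarith

end Assembled

end Summit.QuantumFields.BalabanUV.T4Continuum.ShellMeasureLandauEndRayStokesAssembledDecay

end
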